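import Summits.RiemannHypothesis.RiemannHypothesis.Theorems.Splittings.LinearRayFiniteReach
import HarnessLib

/-!
# The quadrature-free dip certificate against the linear-factor ray — core analysis (abstract `C³` function)

Cell rh-split (D-0116 arm), ENGINE 5 (rh-splitx-eng-5 g4); tools for route item `stmt-RiemannHypothesis-21602`
(`LinearRayDipCertificate`, LINE «QUADRATURE-FREE DIP SCHEDULE», planner rh-idea-2).  For a real `C³` function
`g` (derivative data `g₁, g₂, g₃`): one integration by parts on `[0, ℓ]` with the weight `e^{−at}` (`ibp_Icc`), the
weighted bound `|∫₀^ℓ e^{−at}g₃| ≤ M₃/a` (`abs_integral_exp_mul_le`), the sharp Taylor layers from `|g₃| ≤ M₃`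
(`taylor_layer`: `φ(x′) = 0 ∧ |φ′| ≤ C(x′−τ)^k ⇒ |φ| ≤ C(x′−τ)^{k+1}/(k+1)`), the three-fold integration by parts
`a∫₀^∞ g(s+t)e^{−at}dt ≥ g(s) + g₁(s)/a + g₂(s)/a² − e^{−aℓ}(P + B) − M₃/a³` (`fwdAvg_lower`, tail `g ≥ −B`
beyond `s + ℓ`, boundary bound `P` at `s + ℓ`), and the cubic Taylor lower bound at the dip point
`g(s) + g₁(s)/a + g₂(s)/a² ≥ F₂/(2a²) − d − F₁(1/a + w) − M₃(w³/6 + w²/(2a) + w/a²)` (`taylor_T_lower`; the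
coefficient of `g₂(x′)` is `w²/2 − w/a + 1/a² ≥ 1/(2a²)`).  RH-free, std axioms, no computation.
HONEST LABEL: analysis tools for a negative-side certificate on the RH-STRENGTHENING linear-factor ray; not a
splitting; nothing here bears on the truth of RH.
-/


set_option linter.dupNamespace false

noncomputable section

namespace Summit.RiemannHypothesis.RiemannHypothesis.Theorems.Splittings.LinearRayDipCertificate

open Set MeasureTheory Filter Topology intervalIntegral
open Summit.RiemannHypothesis.RiemannHypothesis.Theorems.Splittings.LinearRayFiniteReach

/-! ## Integration by parts on `[0, ℓ]` -/

/-- One integration by parts on `[0, ℓ]` with the weight `e^{−at}`: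
`a∫₀^ℓ e^{−at}f(s+t)dt = f(s) − e^{−aℓ}f(s+ℓ) + ∫₀^ℓ e^{−at}f′(s+t)dt` (`f ∈ C¹`, `f′` continuous). [folklore] -/
theorem ibp_Icc {f f' : ℝ → ℝ} (hf : ∀ x, HasDerivAt f (f' x) x) (hf' : Continuous f') (a s ℓ : ℝ) :
    a * ∫ t in (0:ℝ)..ℓ, Real.exp (-(a * t)) * f (s + t) =
      f s - Real.exp (-(a * ℓ)) * f (s + ℓ) + ∫ t in (0:ℝ)..ℓ, Real.exp (-(a * t)) * f' (s + t) := by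
  have hfc : Continuous f := continuous_iff_continuousAt.2 fun x => (hf x).continuousAt
  -- φ(t) = −e^{−at} f(s+t)
  have hφ : ∀ t, HasDerivAt (fun t : ℝ => -(Real.exp (-(a * t)) * f (s + t)))
      (a * (Real.exp (-(a * t)) * f (s + t)) - Real.exp (-(a * t)) * f' (s + t)) t := by
    intro t
    have h1 : HasDerivAt (fun t : ℝ => f (s + t)) (f' (s + t)) t := by
      have := (hf (s + t)).comp t ((hasDerivAt_id t).const_add s)
      simpa [Function.comp_def] using this
    have h0 : HasDerivAt (fun t : ℝ => -a * t) (-a * 1) t := (hasDerivAt_id' t).const_mul (-a)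
    have h2 : HasDerivAt (fun t : ℝ => Real.exp (-(a * t))) (Real.exp (-(a * t)) * (-a)) t := by
      have : HasDerivAt (fun t : ℝ => -(a * t)) (-a) t := by
        refine (h0.congr_of_eventuallyEq ?_).congr_deriv (by ring)
        exact Filter.Eventually.of_forall fun x => by ring
      exact this.exp
    have h3 := (h2.mul h1).neg
    exact h3.congr_deriv (by ring)
  have hint1 : IntervalIntegrable (fun t => Real.exp (-(a * t)) * f (s + t)) volume 0 ℓ :=
    (Continuous.intervalIntegrable (by fun_prop) _ _)
  have hint2 : IntervalIntegrable (fun t => Real.exp (-(a * t)) * f' (s + t)) volume 0 ℓ :=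
    ((by fun_prop : Continuous fun t : ℝ => Real.exp (-(a * t))).mul
      (hf'.comp (continuous_const.add continuous_id))).intervalIntegrable _ _
  have key := integral_eq_sub_of_hasDerivAt (a := (0:ℝ)) (b := ℓ) (fun t _ => hφ t)
    ((hint1.const_mul a).sub hint2)
  rw [intervalIntegral.integral_sub (hint1.const_mul a) hint2, intervalIntegral.integral_const_mul] at key
  simp only [mul_zero, neg_zero, Real.exp_zero, one_mul, add_zero] at key
  linarith

/-- `∫₀^ℓ e^{−at}dt ≤ 1/a` for `a > 0`, `ℓ ≥ 0`; and the weighted bound `|∫₀^ℓ e^{−at}g(s+t)dt| ≤ M/a` when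
`|g| ≤ M` on `[s, s+ℓ]`. [folklore] -/
theorem abs_integral_exp_mul_le {g : ℝ → ℝ} (hg : Continuous g) {M a s ℓ : ℝ} (ha : 0 < a) (hℓ : 0 ≤ ℓ)
    (hM : ∀ t ∈ Icc (0:ℝ) ℓ, |g (s + t)| ≤ M) :
    |∫ t in (0:ℝ)..ℓ, Real.exp (-(a * t)) * g (s + t)| ≤ M / a := by
  have hM0 : 0 ≤ M := (abs_nonneg _).trans (hM 0 ⟨le_rfl, hℓ⟩)
  -- ∫₀^ℓ e^{−at} = (1 − e^{−aℓ})/a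
  have hE : ∫ t in (0:ℝ)..ℓ, Real.exp (-(a * t)) = (1 - Real.exp (-(a * ℓ))) / a := by
    have hd : ∀ t ∈ uIcc (0:ℝ) ℓ, HasDerivAt (fun t : ℝ => -(Real.exp (-(a * t))) / a) (Real.exp (-(a * t))) t := by
      intro t _
      have h0 : HasDerivAt (fun t : ℝ => -a * t) (-a * 1) t := (hasDerivAt_id' t).const_mul (-a)
      have h1 : HasDerivAt (fun t : ℝ => -(a * t)) (-a) t := by
        refine (h0.congr_of_eventuallyEq ?_).congr_deriv (by ring)
        exact Filter.Eventually.of_forall fun x => by ring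
      have h2 := (h1.exp.neg).div_const a
      refine h2.congr_deriv ?_
      field_simp
    rw [integral_eq_sub_of_hasDerivAt hd ((by fun_prop : Continuous fun t : ℝ => Real.exp (-(a * t))).intervalIntegrable _ _)]
    simp only [mul_zero, neg_zero, Real.exp_zero]
    field_simp
    ring
  have h1 : |∫ t in (0:ℝ)..ℓ, Real.exp (-(a * t)) * g (s + t)| ≤ ∫ t in (0:ℝ)..ℓ, M * Real.exp (-(a * t)) := by
    refine (abs_integral_le_integral_abs hℓ).trans (integral_mono_on hℓ ?_ ?_ fun t ht => ?_)
    · exact (((by fun_prop : Continuous fun t : ℝ => Real.exp (-(a * t))).mul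
        (hg.comp (continuous_const.add continuous_id))).abs).intervalIntegrable _ _
    · exact (by fun_prop : Continuous fun t : ℝ => M * Real.exp (-(a * t))).intervalIntegrable _ _
    · rw [abs_mul, abs_of_pos (Real.exp_pos _), mul_comm]
      exact mul_le_mul_of_nonneg_right (hM t ht) (Real.exp_pos _).le
  refine h1.trans ?_
  rw [intervalIntegral.integral_const_mul, hE]
  have hexp : 0 < Real.exp (-(a * ℓ)) := Real.exp_pos _
  have : M * ((1 - Real.exp (-(a * ℓ))) / a) ≤ M * (1 / a) :=
    mul_le_mul_of_nonneg_left (div_le_div_of_nonneg_right (by linarith) ha.le) hM0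
  calc M * ((1 - Real.exp (-(a * ℓ))) / a) ≤ M * (1 / a) := this
    _ = M / a := by ring

/-! ## Sharp Taylor layers from a third-derivative bound -/

/-- **One Taylor layer.** If `φ(x′) = 0` and `|φ′(τ)| ≤ C(x′ − τ)^k` on `[s₀, x′]` (`φ ∈ C¹`), then
`|φ(τ)| ≤ C(x′ − τ)^{k+1}/(k+1)` on `[s₀, x′]`. [folklore] -/
theorem taylor_layer {φ φ' : ℝ → ℝ} (hφ : ∀ x, HasDerivAt φ (φ' x) x) {s₀ x' C : ℝ} (k : ℕ)
    (hzero : φ x' = 0) (hbound : ∀ τ ∈ Icc s₀ x', |φ' τ| ≤ C * (x' - τ) ^ k) {τ : ℝ} (hτ : τ ∈ Icc s₀ x') :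
    |φ τ| ≤ C * (x' - τ) ^ (k + 1) / (k + 1) := by
  have hk1 : (0:ℝ) < k + 1 := by positivity
  -- ψ±(u) = φ(u) ∓ C (x' − u)^{k+1}/(k+1)
  have hpow : ∀ u, HasDerivAt (fun u : ℝ => C * (x' - u) ^ (k + 1) / (k + 1)) (-(C * (x' - u) ^ k)) u := by
    intro u
    have h1 : HasDerivAt (fun u : ℝ => x' - u) (-1) u := by
      simpa using (hasDerivAt_id u).const_sub x'
    have h2 := h1.pow (k + 1)
    have h3 := (h2.const_mul C).div_const ((k:ℝ) + 1)
    refine h3.congr_deriv ?_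
    field_simp
    push_cast
    ring
  have hcont : ContinuousOn φ (Icc s₀ x') := fun u _ => (hφ u).continuousAt.continuousWithinAt
  have hAd : ∀ u, HasDerivAt (fun u => φ u + C * (x' - u) ^ (k + 1) / (k + 1)) (φ' u + -(C * (x' - u) ^ k)) u :=
    fun u => (hφ u).add (hpow u)
  have hBd : ∀ u, HasDerivAt (fun u => φ u - C * (x' - u) ^ (k + 1) / (k + 1)) (φ' u - -(C * (x' - u) ^ k)) u :=
    fun u => (hφ u).sub (hpow u)
  -- A(u) = φ u + C (x'-u)^{k+1}/(k+1) is antitone (A' = φ' − C(x'−u)^k ≤ 0); B(u) = φ u − … is monotone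
  have hA : AntitoneOn (fun u => φ u + C * (x' - u) ^ (k + 1) / (k + 1)) (Icc s₀ x') := by
    refine antitoneOn_of_deriv_nonpos (convex_Icc _ _)
      (fun u hu => (hAd u).continuousAt.continuousWithinAt)
      (fun u _ => (hAd u).differentiableAt.differentiableWithinAt) fun u hu => ?_
    rw [(hAd u).deriv]
    rw [interior_Icc] at hu
    have := (abs_le.1 (hbound u (Ioo_subset_Icc_self hu))).2
    linarith
  have hB : MonotoneOn (fun u => φ u - C * (x' - u) ^ (k + 1) / (k + 1)) (Icc s₀ x') := by
    refine monotoneOn_of_deriv_nonneg (convex_Icc _ _)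
      (fun u hu => (hBd u).continuousAt.continuousWithinAt)
      (fun u _ => (hBd u).differentiableAt.differentiableWithinAt) fun u hu => ?_
    rw [(hBd u).deriv]
    rw [interior_Icc] at hu
    have := (abs_le.1 (hbound u (Ioo_subset_Icc_self hu))).1
    linarith
  have hx' : x' ∈ Icc s₀ x' := ⟨hτ.1.trans hτ.2, le_rfl⟩
  have h1 := hA hτ hx' hτ.2   -- A x' ≤ A τ
  have h2 := hB hτ hx' hτ.2   -- B τ ≤ B x'
  simp only [hzero, sub_self, zero_pow (Nat.succ_ne_zero k), mul_zero, zero_div, add_zero] at h1 h2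
  rw [abs_le]
  constructor <;> linarith

/-! ## The forward average at a dip: lower bound and positivity (abstract `C³` function) -/

/-- **The quadrature-free lower bound.** For `g ∈ C³` (derivatives `g₁, g₂, g₃`, all global; `g` bounded,
`g₃` continuous), `a > 0`, `ℓ > 0`, `s ≤ x′`, with `|g₃| ≤ M₃` on `[s, x′ + ℓ]`, the boundary bound
`|g| + |g₁|/a + |g₂|/a² ≤ P` at `s + ℓ`, and the tail `g ≥ −B` on `[s + ℓ, ∞)`:
`a·∫₀^∞ g(s+t)e^{−at}dt ≥ T(s) − e^{−aℓ}(P + B) − M₃/a³`, `T(s) = g(s) + g₁(s)/a + g₂(s)/a²`. [folklore] -/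
theorem fwdAvg_lower {g g₁ g₂ g₃ : ℝ → ℝ} (hd0 : ∀ x, HasDerivAt g (g₁ x) x) (hd1 : ∀ x, HasDerivAt g₁ (g₂ x) x)
    (hd2 : ∀ x, HasDerivAt g₂ (g₃ x) x) (hc3 : Continuous g₃) {M₀ : ℝ} (hM₀ : ∀ x, |g x| ≤ M₀)
    {a ℓ s x' M₃ P B : ℝ} (ha : 0 < a) (hℓ : 0 < ℓ) (hsx' : s ≤ x')
    (hM3 : ∀ t ∈ Icc s (x' + ℓ), |g₃ t| ≤ M₃)
    (hP : |g (s + ℓ)| + |g₁ (s + ℓ)| / a + |g₂ (s + ℓ)| / a ^ 2 ≤ P)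
    (hB : ∀ t : ℝ, s + ℓ ≤ t → -B ≤ g t) :
    g s + g₁ s / a + g₂ s / a ^ 2 - Real.exp (-(a * ℓ)) * (P + B) - M₃ / a ^ 3 ≤
      a * ∫ t in Ioi (0:ℝ), g (s + t) * Real.exp (-(a * t)) := by
  have hc0 : Continuous g := continuous_iff_continuousAt.2 fun x => (hd0 x).continuousAt
  have hc1 : Continuous g₁ := continuous_iff_continuousAt.2 fun x => (hd1 x).continuousAt
  have hc2 : Continuous g₂ := continuous_iff_continuousAt.2 fun x => (hd2 x).continuousAt
  -- integrability and the split at ℓ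
  obtain ⟨hI0, -⟩ := laplaceFwd_bound hc0 hM₀ ha s
  have hIℓ : IntegrableOn (fun t : ℝ => g (s + t) * Real.exp (-(a * t))) (Ioi ℓ) :=
    hI0.mono_set (Ioi_subset_Ioi hℓ.le)
  have hsplit := intervalIntegral.integral_interval_add_Ioi hI0 hIℓ
  -- three integrations by parts on [0, ℓ]
  have e1 := ibp_Icc hd0 hc1 a s ℓ
  have e2 := ibp_Icc hd1 hc2 a s ℓ
  have e3 := ibp_Icc hd2 hc3 a s ℓ
  set I0 := ∫ t in (0:ℝ)..ℓ, Real.exp (-(a * t)) * g (s + t) with hI0def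
  set I1 := ∫ t in (0:ℝ)..ℓ, Real.exp (-(a * t)) * g₁ (s + t)
  set I2 := ∫ t in (0:ℝ)..ℓ, Real.exp (-(a * t)) * g₂ (s + t)
  set I3 := ∫ t in (0:ℝ)..ℓ, Real.exp (-(a * t)) * g₃ (s + t)
  set E := Real.exp (-(a * ℓ)) with hEdef
  have hE0 : 0 < E := Real.exp_pos _
  have hE1 : E ≤ 1 := by rw [hEdef]; exact Real.exp_le_one_iff.2 (by nlinarith)
  -- a I0 = g s − E g(s+ℓ) + I1 ; a I1 = g₁ s − E g₁(s+ℓ) + I2 ; a I2 = g₂ s − E g₂(s+ℓ) + I3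
  have hI3 : |I3| ≤ M₃ / a :=
    abs_integral_exp_mul_le hc3 ha hℓ.le fun t ht => hM3 (s + t) ⟨by linarith [ht.1], by linarith [ht.2]⟩
  -- the tail
  have htail : -(B * (E / a)) ≤ ∫ t in Ioi ℓ, g (s + t) * Real.exp (-(a * t)) := by
    have hmaj : IntegrableOn (fun t : ℝ => -B * Real.exp (-a * t)) (Ioi ℓ) :=
      (integrableOn_exp_mul_Ioi (by linarith) ℓ).const_mul (-B)
    have hle : ∀ t ∈ Ioi ℓ, -B * Real.exp (-a * t) ≤ g (s + t) * Real.exp (-(a * t)) := by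
      intro t ht
      rw [show -a * t = -(a * t) by ring]
      have := hB (s + t) (by linarith [(mem_Ioi.1 ht).le])
      nlinarith [Real.exp_pos (-(a * t))]
    have hm := setIntegral_mono_on hmaj hIℓ measurableSet_Ioi hle
    rw [MeasureTheory.integral_const_mul, integral_exp_mul_Ioi (by linarith) ℓ] at hm
    have e : -B * (-Real.exp (-a * ℓ) / -a) = -(B * (E / a)) := by
      rw [hEdef, show -a * ℓ = -(a * ℓ) by ring]; field_simp
    linarith [hm, e.symm.le, e.le]
  -- rewrite the Ioi-0 integral: ∫ g(s+t) e^{-at} over Ioi 0 = I0' + tail where I0' has the factors swapped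
  have hswap : (∫ t in (0:ℝ)..ℓ, g (s + t) * Real.exp (-(a * t))) = I0 := by
    rw [hI0def]; congr 1; funext t; ring
  rw [← hsplit, hswap]
  -- algebra: a*(I0 + tail) ≥ ...
  have ha2 : 0 < a ^ 2 := by positivity
  have ha3 : 0 < a ^ 3 := by positivity
  have hI2 : a * I2 = g₂ s - E * g₂ (s + ℓ) + I3 := e3
  have hI1 : a * I1 = g₁ s - E * g₁ (s + ℓ) + I2 := e2
  have hI0 : a * I0 = g s - E * g (s + ℓ) + I1 := e1
  -- a I0 = g + g₁/a + g₂/a² − E (g(s+ℓ) + g₁(s+ℓ)/a + g₂(s+ℓ)/a²) + I3/a²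
  have hexp : a * I0 = g s + g₁ s / a + g₂ s / a ^ 2
      - E * (g (s + ℓ) + g₁ (s + ℓ) / a + g₂ (s + ℓ) / a ^ 2) + I3 / a ^ 2 := by
    field_simp
    nlinarith [hI0, hI1, hI2]
  -- bounds on the boundary bracket and I3
  have hbr : E * (g (s + ℓ) + g₁ (s + ℓ) / a + g₂ (s + ℓ) / a ^ 2) ≤ E * P := by
    refine mul_le_mul_of_nonneg_left ?_ hE0.le
    have h1 : g (s + ℓ) ≤ |g (s + ℓ)| := le_abs_self _
    have h2 : g₁ (s + ℓ) / a ≤ |g₁ (s + ℓ)| / a := div_le_div_of_nonneg_right (le_abs_self _) ha.le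
    have h3 : g₂ (s + ℓ) / a ^ 2 ≤ |g₂ (s + ℓ)| / a ^ 2 := div_le_div_of_nonneg_right (le_abs_self _) ha2.le
    linarith
  have hI3' : -(M₃ / a ^ 3) ≤ I3 / a ^ 2 := by
    have := (abs_le.1 hI3).1
    have e : M₃ / a ^ 3 = (M₃ / a) / a ^ 2 := by field_simp
    rw [e, ← neg_div]
    exact div_le_div_of_nonneg_right this ha2.le
  have htail' : -(E * B) ≤ a * ∫ t in Ioi ℓ, g (s + t) * Real.exp (-(a * t)) := by
    have := mul_le_mul_of_nonneg_left htail ha.le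
    have e : a * -(B * (E / a)) = -(E * B) := by field_simp
    linarith
  rw [mul_add]
  linarith

/-- **Cubic Taylor lower bound at the dip point.** For `g ∈ C³` with `|g₃| ≤ M₃` on `[s, x′]` (`s ≤ x′`),
`−d ≤ g(x′)`, `|g₁(x′)| ≤ F₁`, `0 ≤ F₂ ≤ g₂(x′)`, `a > 0`, and `w = x′ − s`:
`F₂/(2a²) − d − F₁(1/a + w) − M₃(w³/6 + w²/(2a) + w/a²) ≤ g(s) + g₁(s)/a + g₂(s)/a²`
(the coefficient of `g₂(x′)` is `w²/2 − w/a + 1/a² ≥ 1/(2a²)`). [folklore] -/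
theorem taylor_T_lower {g g₁ g₂ g₃ : ℝ → ℝ} (hd0 : ∀ x, HasDerivAt g (g₁ x) x) (hd1 : ∀ x, HasDerivAt g₁ (g₂ x) x)
    (hd2 : ∀ x, HasDerivAt g₂ (g₃ x) x) {s x' a d F₁ F₂ M₃ : ℝ} (hsx' : s ≤ x') (ha : 0 < a)
    (hM3 : ∀ t ∈ Icc s x', |g₃ t| ≤ M₃) (hd : -d ≤ g x') (hF1 : |g₁ x'| ≤ F₁) (hF20 : 0 ≤ F₂) (hF2 : F₂ ≤ g₂ x') :
    F₂ / (2 * a ^ 2) - d - F₁ * (1 / a + (x' - s)) -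
        M₃ * ((x' - s) ^ 3 / 6 + (x' - s) ^ 2 / (2 * a) + (x' - s) / a ^ 2) ≤
      g s + g₁ s / a + g₂ s / a ^ 2 := by
  have ha2 : 0 < a ^ 2 := by positivity
  set w := x' - s with hw
  have hw0 : 0 ≤ w := by rw [hw]; linarith
  -- layer 0
  have hL0 : ∀ τ ∈ Icc s x', |g₂ τ - g₂ x'| ≤ M₃ * (x' - τ) := by
    intro τ hτ
    have h := taylor_layer (φ := fun u => g₂ u - g₂ x') (φ' := g₃) (C := M₃) (fun u => (hd2 u).sub_const _) 0
      (by simp) (fun u hu => by simpa using hM3 u hu) hτ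
    simpa using h
  -- layer 1
  have hder1 : ∀ u, HasDerivAt (fun u => g₁ u - g₁ x' + g₂ x' * (x' - u)) (g₂ u - g₂ x') u := by
    intro u
    have h1 : HasDerivAt (fun u : ℝ => x' - u) (-1) u := by
      simpa using (hasDerivAt_id u).const_sub x'
    have := ((hd1 u).sub_const (g₁ x')).add (h1.const_mul (g₂ x'))
    exact this.congr_deriv (by ring)
  have hL1 : ∀ τ ∈ Icc s x', |g₁ τ - g₁ x' + g₂ x' * (x' - τ)| ≤ M₃ * (x' - τ) ^ 2 / 2 := by
    intro τ hτ
    have h := taylor_layer (C := M₃) hder1 1 (by simp) (fun u hu => by simpa using hL0 u hu) hτ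
    norm_num at h
    exact h
  -- layer 2
  have hder2 : ∀ u, HasDerivAt (fun u => g u - g x' + g₁ x' * (x' - u) - g₂ x' * (x' - u) ^ 2 / 2)
      (g₁ u - g₁ x' + g₂ x' * (x' - u)) u := by
    intro u
    have h1 : HasDerivAt (fun u : ℝ => x' - u) (-1) u := by
      simpa using (hasDerivAt_id u).const_sub x'
    have h2 := h1.pow 2
    have := (((hd0 u).sub_const (g x')).add (h1.const_mul (g₁ x'))).sub ((h2.const_mul (g₂ x')).div_const 2)
    refine this.congr_deriv ?_
    simp only [Nat.cast_ofNat]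
    ring
  have hL2 : ∀ τ ∈ Icc s x', |g τ - g x' + g₁ x' * (x' - τ) - g₂ x' * (x' - τ) ^ 2 / 2| ≤ M₃ * (x' - τ) ^ 3 / 6 := by
    intro τ hτ
    have h := taylor_layer (C := M₃ / 2) hder2 2 (by simp) (fun u hu => by
      have := hL1 u hu
      have e : M₃ * (x' - u) ^ 2 / 2 = M₃ / 2 * (x' - u) ^ 2 := by ring
      rw [e] at this; exact this) hτ
    norm_num at h
    have e : M₃ / 2 * (x' - τ) ^ 3 / 3 = M₃ * (x' - τ) ^ 3 / 6 := by ring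
    rw [e] at h; exact h
  -- at τ = s
  have hsI : s ∈ Icc s x' := ⟨le_rfl, hsx'⟩
  have t0 := (abs_le.1 (hL0 s hsI)).1
  have t1 := (abs_le.1 (hL1 s hsI)).1
  have t2 := (abs_le.1 (hL2 s hsI)).1
  rw [← hw] at t0 t1 t2
  -- lower bounds of g s, g₁ s, g₂ s
  have e2 : g₂ x' - M₃ * w ≤ g₂ s := by linarith
  have e1 : g₁ x' - g₂ x' * w - M₃ * w ^ 2 / 2 ≤ g₁ s := by linarith
  have e0 : g x' - g₁ x' * w + g₂ x' * w ^ 2 / 2 - M₃ * w ^ 3 / 6 ≤ g s := by linarith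
  have e1' := div_le_div_of_nonneg_right e1 ha.le
  have e2' := div_le_div_of_nonneg_right e2 ha2.le
  -- the combination
  have hsum : g x' + g₁ x' * (1 / a - w) + g₂ x' * (w ^ 2 / 2 - w / a + 1 / a ^ 2)
      - M₃ * (w ^ 3 / 6 + w ^ 2 / (2 * a) + w / a ^ 2) =
      (g x' - g₁ x' * w + g₂ x' * w ^ 2 / 2 - M₃ * w ^ 3 / 6) + (g₁ x' - g₂ x' * w - M₃ * w ^ 2 / 2) / a
        + (g₂ x' - M₃ * w) / a ^ 2 := by
    field_simp
    ring
  have hq : 1 / (2 * a ^ 2) ≤ w ^ 2 / 2 - w / a + 1 / a ^ 2 := by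
    have : w ^ 2 / 2 - w / a + 1 / a ^ 2 - 1 / (2 * a ^ 2) = (w - 1 / a) ^ 2 / 2 := by field_simp; ring
    nlinarith [sq_nonneg (w - 1 / a)]
  have hg2nn : 0 ≤ g₂ x' := hF20.trans hF2
  have hA : F₂ * (1 / (2 * a ^ 2)) ≤ g₂ x' * (w ^ 2 / 2 - w / a + 1 / a ^ 2) :=
    mul_le_mul hF2 hq (by positivity) hg2nn
  have hg1x := abs_le.1 hF1
  have hB1 : -(F₁ * w) ≤ -(g₁ x' * w) := by nlinarith [hg1x.2, hw0]
  have hB2 : -(F₁ * (1 / a)) ≤ g₁ x' * (1 / a) := by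
    have : -F₁ * (1 / a) ≤ g₁ x' * (1 / a) := mul_le_mul_of_nonneg_right hg1x.1 (by positivity)
    linarith
  have hB : -(F₁ * (1 / a + w)) ≤ g₁ x' * (1 / a - w) := by nlinarith [hB1, hB2]
  have eF : F₂ / (2 * a ^ 2) = F₂ * (1 / (2 * a ^ 2)) := by ring
  rw [eF]
  linarith [hsum, hA, hB, e0, e1', e2', hd]

end Summit.RiemannHypothesis.RiemannHypothesis.Theorems.Splittings.LinearRayDipCertificate

end
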